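import Summits.ValiantsHypothesis.ValiantsHypothesis.Theorems.SymPencilRadicalSumSquares
import Summits.ValiantsHypothesis.ValiantsHypothesis.Theorems.SymPencilPerFourIsotropicPairRank
import Literature.Computability.AlgebraicComplexity.PerStabilizerMarcusMay
import Literature.Computability.AlgebraicComplexity.StandardFamilies

/-!
# Route `SymPencil` — the ZERO-ROW BRIDGE: along a direction with a zero row, FIVE weighted squares are FOUR
# (`--supports` stmt-ValiantsHypothesis-5674 `SdcSuperquadratic`; row `r = 11` of the size-`28` kernel-package table,
# part (a) of the `(11, 5, 5)` plan; rung currency only — nothing here bears on `VP ≠ VNP`)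

Row `r = 11` of the size-`28` table asks for «no `5`-dimensional `W ⊆ Sing₃` carries a JOINT family of FIVE squares»
(`27 - 2·11 = 5`), one square more than the ✓ size-`27` cell `(11, 5, 4)` (`SymPencilSingFiveClassification`).  The
leaves R2 / R1C / R1N of that cell consume the PER-DIRECTION family of FOUR squares (`PerDirFour`); this file shows that on
every `W` with a ZERO ROW the per-direction family of five squares already is one of four squares, so those leaves apply
BY NAME at five.

* `sum_sq_four_of_split` (linear algebra, characteristic `0`): if `Q = Σ_{k<5} c_k Λ_k²` vanishes on two subspaces
  `A, B` with `A ⊔ B = ⊤` (a «pairing» form), then `Q = Σ_{k<4} c'_k Λ'_k²`.  Either some weight is zero (drop it), or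
  the polar map `u ↦ (v ↦ Σ_k c_k Λ_k(u) Λ_k(v))` has rank `≤ dim Λ(A) + dim Λ(B) ≤ 2 + 2` because `Λ(A)`, `Λ(B)` are
  totally isotropic in the non-degenerate diagonal space `(K⁵, Σ c_k v_k w_k)`
  (✓ `SymPencilPerFourIsotropicPairRank.two_mul_finrank_range_le_of_isotropic`); its kernel has codimension `≤ 4` and lies
  in the radical, so ✓ `SymPencilRadicalSumSquares.exists_sum_sq_of_le_radical` gives four squares.
* `sumSq_four_of_five_of_zeroRow` (the bridge, pointwise): if row `i` of `y` vanishes and the `s²`-coefficient of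
  `per₄ (u + s y)` is `Σ_{k<5} c_k Λ_k(u)²` for every `u`, then it is `Σ_{k<4} c'_k Λ'_k(u)²` for every `u`: the
  `s²`-form vanishes on `A = {u supported on row i}` (`per₄ (a + s y) = s³ · per₄ (a + y)`, Marcus–May row scaling
  ✓ `permanent_diagonal_mul`) and on `B = {u : row i of u = 0}` (a zero row), and `A ⊔ B = ⊤`.
* `perDirFour_of_perDirFive_of_zeroRow`: the `W`-level form (hypotheses and conclusion UNFOLDED, the shapes of
  `SymPencilSingFiveClassification.PerDirFour` with `Fin 5` resp. `Fin 4`).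

Honest framing: pure linear algebra plus one permanent expansion; no cell closes here; row `11` of the size-`28` table and
`28 ≤ sdc(per₄) ≤ 29` are UNCHANGED by this file alone; stmt-5674 `SdcSuperquadratic` OPEN; `VP ≠ VNP` not moved; no summit
statement is proved here.  No definitions, no named facts. [folklore]
-/

noncomputable section

-- single-conjunct layout: Sub = Summit, duplicated namespace component intended
set_option linter.dupNamespace false

namespace Summit.ValiantsHypothesis.ValiantsHypothesis.Theorems.SymPencilSingFiveZeroRowBridge

open MvPolynomial Module Matrix
open Literature.Computability.AlgebraicComplexity
open Summit.ValiantsHypothesis.ValiantsHypothesis.Theorems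

variable {K : Type*} [Field K]

/-! ## 1. Small algebra -/

/-- Polarisation of a weighted sum of squares. [folklore] -/
theorem sum_sq_add {ι : Type*} [Fintype ι] (c x y : ι → K) :
    ∑ k, c k * (x k + y k) ^ 2 =
      ∑ k, c k * (x k) ^ 2 + ∑ k, c k * (y k) ^ 2 + 2 * ∑ k, c k * x k * y k := by
  simp only [Finset.mul_sum, ← Finset.sum_add_distrib]
  exact Finset.sum_congr rfl fun k _ => by ring

/-- The `s²`-coefficient of a polynomial identity `e₀ + s e₁ + s² q = s³ C` (all `s`) vanishes. [folklore] -/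
theorem coeff_sq_eq_zero_of_cubic [CharZero K] {e₀ e₁ q C : K}
    (h : ∀ s : K, e₀ + s * e₁ + s ^ 2 * q = s ^ 3 * C) : q = 0 := by
  have h0 := h 0
  have h1 := h 1
  have h2 := h (-1)
  have h2q : (2 : K) * q = 0 := by linear_combination h1 + h2 - 2 * h0
  exact (mul_eq_zero.1 h2q).resolve_left two_ne_zero

/-- Dropping a zero weight: five weighted squares with `c k₀ = 0` are four. [folklore] -/
theorem sum_sq_four_of_weight_zero {V : Type*} [AddCommGroup V] [Module K V]
    (c : Fin 5 → K) (Λ : Fin 5 → (V →ₗ[K] K)) (k₀ : Fin 5) (hk : c k₀ = 0) :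
    ∃ (c' : Fin 4 → K) (Λ' : Fin 4 → (V →ₗ[K] K)),
      ∀ u, ∑ k, c k * (Λ k u) ^ 2 = ∑ k, c' k * (Λ' k u) ^ 2 := by
  refine ⟨fun j => c (k₀.succAbove j), fun j => Λ (k₀.succAbove j), fun u => ?_⟩
  rw [Fin.sum_univ_succAbove _ k₀, hk, zero_mul, zero_add]

/-! ## 2. A pairing form in five weighted squares is one in four -/

/-- **Split forms: five squares are four.**  If `Q = Σ_{k<5} c_k Λ_k²` vanishes identically on `A` and on `B`
with `A ⊔ B = ⊤`, then `Q = Σ_{k<4} c'_k Λ'_k²` (characteristic `0`). [folklore] -/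
theorem sum_sq_four_of_split [CharZero K] {V : Type*} [AddCommGroup V] [Module K V]
    [FiniteDimensional K V] (A B : Submodule K V) (hAB : A ⊔ B = ⊤)
    (c : Fin 5 → K) (Λ : Fin 5 → (V →ₗ[K] K))
    (hA : ∀ a ∈ A, ∑ k, c k * (Λ k a) ^ 2 = 0) (hB : ∀ b ∈ B, ∑ k, c k * (Λ k b) ^ 2 = 0) :
    ∃ (c' : Fin 4 → K) (Λ' : Fin 4 → (V →ₗ[K] K)),
      ∀ u, ∑ k, c k * (Λ k u) ^ 2 = ∑ k, c' k * (Λ' k u) ^ 2 := by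
  classical
  by_cases hc : ∃ k₀, c k₀ = 0
  · obtain ⟨k₀, hk⟩ := hc
    exact sum_sq_four_of_weight_zero c Λ k₀ hk
  push Not at hc
  -- the polar bilinear map `Bil u v = Σ_k c_k Λ_k(u) Λ_k(v)`
  let Bil : V →ₗ[K] V →ₗ[K] K :=
    LinearMap.mk₂ K (fun u v => ∑ k, c k * Λ k u * Λ k v)
      (fun u u' v => by
        simp only [map_add, ← Finset.sum_add_distrib]
        exact Finset.sum_congr rfl fun k _ => by ring)
      (fun a u v => by
        simp only [map_smul, smul_eq_mul, Finset.mul_sum]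
        exact Finset.sum_congr rfl fun k _ => by ring)
      (fun u v v' => by
        simp only [map_add, ← Finset.sum_add_distrib]
        exact Finset.sum_congr rfl fun k _ => by ring)
      (fun a u v => by
        simp only [map_smul, smul_eq_mul, Finset.mul_sum]
        exact Finset.sum_congr rfl fun k _ => by ring)
  have hBil : ∀ u v, Bil u v = ∑ k, c k * Λ k u * Λ k v := fun u v => rfl
  have hBsymm : ∀ u v, Bil u v = Bil v u := fun u v => by
    rw [hBil, hBil]; exact Finset.sum_congr rfl fun k _ => by ring
  have hBdiag : ∀ u, Bil u u = ∑ k, c k * (Λ k u) ^ 2 := fun u => by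
    rw [hBil]; exact Finset.sum_congr rfl fun k _ => by ring
  -- polarisation on `A` and on `B`
  have polA : ∀ a ∈ A, ∀ a' ∈ A, Bil a a' = 0 := by
    intro a ha a' ha'
    have h := hA (a + a') (A.add_mem ha ha')
    simp only [map_add] at h
    rw [sum_sq_add, hA a ha, hA a' ha', zero_add, zero_add] at h
    rw [hBil]
    exact (mul_eq_zero.1 h).resolve_left two_ne_zero
  have polB : ∀ b ∈ B, ∀ b' ∈ B, Bil b b' = 0 := by
    intro b hb b' hb'
    have h := hB (b + b') (B.add_mem hb hb')
    simp only [map_add] at h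
    rw [sum_sq_add, hB b hb, hB b' hb', zero_add, zero_add] at h
    rw [hBil]
    exact (mul_eq_zero.1 h).resolve_left two_ne_zero
  -- the coordinate map `Φ u = (Λ_k u)_k` and the recombination `T x = Σ_k (c_k x_k) • Λ_k`
  let Φ : V →ₗ[K] (Fin 5 → K) := LinearMap.pi fun k => Λ k
  have hΦ : ∀ u k, Φ u k = Λ k u := fun u k => rfl
  let T : (Fin 5 → K) →ₗ[K] (V →ₗ[K] K) :=
    { toFun := fun x => ∑ k, (c k * x k) • Λ k
      map_add' := fun x x' => by
        simp only [Pi.add_apply, mul_add, add_smul, Finset.sum_add_distrib]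
      map_smul' := fun a x => by
        simp only [Pi.smul_apply, smul_eq_mul, RingHom.id_apply, Finset.smul_sum, smul_smul]
        exact Finset.sum_congr rfl fun k _ => by ring_nf }
  have hT : ∀ u, T (Φ u) = Bil u := by
    intro u
    ext v
    simp only [T, LinearMap.coe_mk, AddHom.coe_mk, LinearMap.coe_sum, Finset.sum_apply,
      LinearMap.smul_apply, smul_eq_mul, hΦ, hBil]
  -- rank of `Bil` restricted to `A` (resp. `B`) is at most `2`
  have rankA : finrank K (LinearMap.range (Bil ∘ₗ A.subtype)) ≤ 2 := by
    have hiso : ∀ a a' : A, ∑ r, c r * (Φ ∘ₗ A.subtype) a r * (Φ ∘ₗ A.subtype) a' r = 0 := by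
      intro a a'
      have h := polA a a.2 a' a'.2
      rw [hBil] at h
      simpa only [LinearMap.coe_comp, Function.comp_apply, Submodule.coe_subtype, hΦ] using h
    have h2 := SymPencilPerFourIsotropicPairRank.two_mul_finrank_range_le_of_isotropic c hc
      (Φ ∘ₗ A.subtype) hiso
    have hcomp : Bil ∘ₗ A.subtype = T ∘ₗ (Φ ∘ₗ A.subtype) := by
      ext a v
      simp only [LinearMap.coe_comp, Function.comp_apply, hT]
    rw [hcomp, LinearMap.range_comp]
    have := Submodule.finrank_map_le T (LinearMap.range (Φ ∘ₗ A.subtype))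
    simp only [Fintype.card_fin] at h2
    omega
  have rankB : finrank K (LinearMap.range (Bil ∘ₗ B.subtype)) ≤ 2 := by
    have hiso : ∀ b b' : B, ∑ r, c r * (Φ ∘ₗ B.subtype) b r * (Φ ∘ₗ B.subtype) b' r = 0 := by
      intro b b'
      have h := polB b b.2 b' b'.2
      rw [hBil] at h
      simpa only [LinearMap.coe_comp, Function.comp_apply, Submodule.coe_subtype, hΦ] using h
    have h2 := SymPencilPerFourIsotropicPairRank.two_mul_finrank_range_le_of_isotropic c hc
      (Φ ∘ₗ B.subtype) hiso
    have hcomp : Bil ∘ₗ B.subtype = T ∘ₗ (Φ ∘ₗ B.subtype) := by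
      ext b v
      simp only [LinearMap.coe_comp, Function.comp_apply, hT]
    rw [hcomp, LinearMap.range_comp]
    have := Submodule.finrank_map_le T (LinearMap.range (Φ ∘ₗ B.subtype))
    simp only [Fintype.card_fin] at h2
    omega
  -- hence `rank Bil ≤ 4`
  have hrange : LinearMap.range Bil ≤
      LinearMap.range (Bil ∘ₗ A.subtype) ⊔ LinearMap.range (Bil ∘ₗ B.subtype) := by
    rintro _ ⟨u, rfl⟩
    have hu : u ∈ A ⊔ B := by rw [hAB]; exact Submodule.mem_top
    obtain ⟨a, ha, b, hb, rfl⟩ := Submodule.mem_sup.1 hu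
    rw [map_add]
    exact Submodule.add_mem_sup ⟨⟨a, ha⟩, rfl⟩ ⟨⟨b, hb⟩, rfl⟩
  have hrank : finrank K (LinearMap.range Bil) ≤ 4 := by
    have h1 := Submodule.finrank_mono hrange
    have h2 := Submodule.finrank_add_le_finrank_add_finrank
      (LinearMap.range (Bil ∘ₗ A.subtype)) (LinearMap.range (Bil ∘ₗ B.subtype))
    omega
  -- the kernel of `Bil` lies in the radical of the quadratic form and has codimension `≤ 4`
  let Q : QuadraticForm K V := LinearMap.BilinMap.toQuadraticMap Bil
  have hQ : ∀ u, Q u = ∑ k, c k * (Λ k u) ^ 2 := fun u => by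
    rw [LinearMap.BilinMap.toQuadraticMap_apply, hBdiag]
  have hker : LinearMap.ker Bil ≤ Q.radical := by
    intro u hu
    rw [LinearMap.mem_ker] at hu
    rw [QuadraticMap.mem_radical_iff']
    refine ⟨?_, fun n => ?_⟩
    · rw [LinearMap.BilinMap.toQuadraticMap_apply, hu, LinearMap.zero_apply]
    · rw [LinearMap.BilinMap.toQuadraticMap_apply, LinearMap.BilinMap.toQuadraticMap_apply]
      simp only [map_add, hu, zero_add]
      rw [hBsymm n u, hu, LinearMap.zero_apply, zero_add]
  have hdim : finrank K V ≤ finrank K (LinearMap.ker Bil) + 4 := by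
    have := LinearMap.finrank_range_add_finrank_ker Bil
    omega
  obtain ⟨c', ℓ, h⟩ := SymPencilRadicalSumSquares.exists_sum_sq_of_le_radical Q _ hker 4 hdim
  exact ⟨c', ℓ, fun u => by rw [← hQ u, h u]⟩

/-! ## 3. The bridge along a direction with a zero row -/

/-- A `4 × 4` matrix with a zero row has permanent zero. [folklore] -/
theorem permanent_eq_zero_of_row_eq_zero {M : Matrix (Fin 4) (Fin 4) K} (i : Fin 4)
    (hM : ∀ j, M i j = 0) : M.permanent = 0 := by
  unfold Matrix.permanent
  refine Finset.sum_eq_zero fun σ _ => ?_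
  exact Finset.prod_eq_zero (Finset.mem_univ (σ.symm i)) (by rw [Equiv.apply_symm_apply]; exact hM _)

/-- `per₄ (b + s y) = 0` when row `i` of `b` and row `i` of `y` both vanish. [folklore] -/
theorem eval_add_smul_eq_zero_of_row (i : Fin 4) {b y : Fin 4 × Fin 4 → K}
    (hb : ∀ j, b (i, j) = 0) (hy : ∀ j, y (i, j) = 0) (s : K) :
    eval (b + s • y) (perPoly (Fin 4) K) = 0 := by
  rw [eval_perPoly]
  exact permanent_eq_zero_of_row_eq_zero i fun j => by simp [hb j, hy j]

/-- `per₄ (a + s y) = s³ · per₄ (a + y)` when `a` is supported on row `i` and row `i` of `y` vanishes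
(Marcus–May row scaling by `diag(1; s, s, s)`, ✓ `MarcusMay.permanent_diagonal_mul`). [folklore] -/
theorem eval_add_smul_eq_cube_of_row (i : Fin 4) {a y : Fin 4 × Fin 4 → K}
    (ha : ∀ r j, r ≠ i → a (r, j) = 0) (hy : ∀ j, y (i, j) = 0) (s : K) :
    eval (a + s • y) (perPoly (Fin 4) K) = s ^ 3 * eval (a + y) (perPoly (Fin 4) K) := by
  rw [eval_perPoly, eval_perPoly]
  have hmat : (Matrix.of fun r j => (a + s • y) (r, j)) =
      Matrix.diagonal (fun r : Fin 4 => if r = i then (1 : K) else s) *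
        Matrix.of fun r j => (a + y) (r, j) := by
    ext r j
    rw [Matrix.diagonal_mul, Matrix.of_apply, Matrix.of_apply]
    simp only [Pi.add_apply, Pi.smul_apply, smul_eq_mul]
    by_cases hr : r = i
    · rw [if_pos hr, hr, hy j]; ring
    · rw [if_neg hr, ha r j hr]; ring
  have hprod : ∏ r : Fin 4, (if r = i then (1 : K) else s) = s ^ 3 := by
    rw [Fin.prod_univ_four]
    fin_cases i <;> simp <;> ring
  rw [hmat, MarcusMay.permanent_diagonal_mul, hprod]

/-- **The zero-row bridge, pointwise.**  If row `i` of the direction `y` vanishes and the `s²`-coefficient of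
`per₄ (u + s y)` is a weighted sum of FIVE squares of linear forms in `u`, then it is a weighted sum of FOUR
squares: the `s²`-form vanishes on `A = {u supported on row i}` and on `B = {u : row i of u = 0}`, `A ⊔ B = ⊤`,
and `sum_sq_four_of_split` applies. [folklore] -/
theorem sumSq_four_of_five_of_zeroRow [CharZero K] (i : Fin 4) {y : Fin 4 × Fin 4 → K}
    (hy : ∀ j, y (i, j) = 0) (c : Fin 5 → K) (Λ : Fin 5 → ((Fin 4 × Fin 4 → K) →ₗ[K] K))
    (hfam : ∀ u : Fin 4 × Fin 4 → K, ∃ e₀ e₁ : K, ∀ s : K,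
      eval (u + s • y) (perPoly (Fin 4) K) = e₀ + s * e₁ + s ^ 2 * ∑ k, c k * (Λ k u) ^ 2) :
    ∃ (c' : Fin 4 → K) (Λ' : Fin 4 → ((Fin 4 × Fin 4 → K) →ₗ[K] K)),
      ∀ u : Fin 4 × Fin 4 → K, ∃ e₀ e₁ : K, ∀ s : K,
        eval (u + s • y) (perPoly (Fin 4) K) = e₀ + s * e₁ + s ^ 2 * ∑ k, c' k * (Λ' k u) ^ 2 := by
  classical
  -- zeroing row `i`: a linear idempotent whose kernel is `A` and whose range is `B`
  let offRow : (Fin 4 × Fin 4 → K) →ₗ[K] (Fin 4 × Fin 4 → K) :=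
    { toFun := fun u p => if p.1 = i then 0 else u p
      map_add' := fun u v => by
        ext p
        simp only [Pi.add_apply]
        split_ifs <;> simp
      map_smul' := fun t u => by
        ext p
        simp only [Pi.smul_apply, smul_eq_mul, RingHom.id_apply]
        split_ifs <;> simp }
  have hoff : ∀ u p, offRow u p = if p.1 = i then 0 else u p := fun u p => rfl
  set A : Submodule K (Fin 4 × Fin 4 → K) := LinearMap.ker offRow with hA_def
  set B : Submodule K (Fin 4 × Fin 4 → K) := LinearMap.range offRow with hB_def
  have hAmem : ∀ a ∈ A, ∀ r j, r ≠ i → a (r, j) = 0 := by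
    intro a ha r j hr
    have h := congr_fun (LinearMap.mem_ker.1 ha) (r, j)
    rwa [hoff, if_neg hr] at h
  have hBmem : ∀ b ∈ B, ∀ j, b (i, j) = 0 := by
    rintro _ ⟨u, rfl⟩ j
    rw [hoff, if_pos rfl]
  have hAB : A ⊔ B = ⊤ := by
    refine Submodule.eq_top_iff'.2 fun u => ?_
    have hu : u = (u - offRow u) + offRow u := by abel
    rw [hu]
    refine Submodule.add_mem_sup ?_ ⟨u, rfl⟩
    rw [hA_def, LinearMap.mem_ker, map_sub]
    ext p
    simp only [Pi.sub_apply, hoff, Pi.zero_apply]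
    split_ifs <;> simp
  -- the five-square form vanishes on `A` and on `B`
  have hQA : ∀ a ∈ A, ∑ k, c k * (Λ k a) ^ 2 = 0 := by
    intro a ha
    obtain ⟨e₀, e₁, he⟩ := hfam a
    exact coeff_sq_eq_zero_of_cubic (C := eval (a + y) (perPoly (Fin 4) K)) fun s => by
      rw [← he s, eval_add_smul_eq_cube_of_row i (hAmem a ha) hy s]
  have hQB : ∀ b ∈ B, ∑ k, c k * (Λ k b) ^ 2 = 0 := by
    intro b hb
    obtain ⟨e₀, e₁, he⟩ := hfam b
    exact coeff_sq_eq_zero_of_cubic (C := 0) fun s => by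
      rw [← he s, eval_add_smul_eq_zero_of_row i (hBmem b hb) hy s, mul_zero]
  obtain ⟨c', Λ', h⟩ := sum_sq_four_of_split A B hAB c Λ hQA hQB
  refine ⟨c', Λ', fun u => ?_⟩
  obtain ⟨e₀, e₁, he⟩ := hfam u
  exact ⟨e₀, e₁, fun s => by rw [he s, h u]⟩

/-- **The zero-row bridge for a space** (`PerDirFive W ⇒ PerDirFour W` of `SymPencilSingFiveClassification`, both
UNFOLDED): if row `i` vanishes on `W`, a per-direction family of FIVE squares on `W` is one of FOUR squares — so the
✓ leaves R2 / R1C / R1N of the size-`27` cell `(11, 5, 4)` apply verbatim in row `11` of the size-`28` table. [folklore] -/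
theorem perDirFour_of_perDirFive_of_zeroRow [CharZero K] (W : Submodule K (Fin 4 × Fin 4 → K)) (i : Fin 4)
    (hrow : ∀ x ∈ W, ∀ j : Fin 4, x (i, j) = 0)
    (hP : ∀ y ∈ W, ∃ (c : Fin 5 → K) (Λ : Fin 5 → ((Fin 4 × Fin 4 → K) →ₗ[K] K)),
      ∀ u : Fin 4 × Fin 4 → K, ∃ e₀ e₁ : K, ∀ s : K,
        eval (u + s • y) (perPoly (Fin 4) K) = e₀ + s * e₁ + s ^ 2 * ∑ k, c k * (Λ k u) ^ 2) :
    ∀ y ∈ W, ∃ (c : Fin 4 → K) (Λ : Fin 4 → ((Fin 4 × Fin 4 → K) →ₗ[K] K)),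
      ∀ u : Fin 4 × Fin 4 → K, ∃ e₀ e₁ : K, ∀ s : K,
        eval (u + s • y) (perPoly (Fin 4) K) = e₀ + s * e₁ + s ^ 2 * ∑ k, c k * (Λ k u) ^ 2 := by
  intro y hy
  obtain ⟨c, Λ, h⟩ := hP y hy
  exact sumSq_four_of_five_of_zeroRow i (hrow y hy) c Λ h

end Summit.ValiantsHypothesis.ValiantsHypothesis.Theorems.SymPencilSingFiveZeroRowBridge
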